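import Summits.QuantumFields.BalabanUV.T4Continuum.Support.ShellMeasureDecayRowsLevelOpCells
import Summits.QuantumFields.BalabanUV.T4Continuum.Support.ShellMeasureSlotCubeFamily

/-!
# `T4Continuum.ShellMeasureDecayRowsLevelOpCellsSlot` — ROW J3 = S118, RULE G-1: the E6-row shape of `ShellMeasureDecayRowsLevelOpCells`
# FIRED on the CONCRETE two-level slot cube family of ROW S117 = J2 (`ShellMeasureSlotCubeFamily`) at the flat gauge point, with
# every geometric and gauge binder supplied and a decided positive-rate instance at `d = 4`
(cell `pub-balaban`, sub-cell `t4`, spine estimate NE7c (node U5b); NE7c ROUND-2 crew `t4-ne7c-formalise-*`, unit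
`b2b-balaban-t4-ne7c-formalise-leaf-02` gen 13; owner table `t4/b2b-balaban-t4-ne7c-p1/LEAVES-NE7c-P1.md` estimate-lane rows S118 = J3
(this lineage) and S117 = J2 (leaf-06-g10); the instantiation pattern is leaf-05-g12's S116 = J1 (b) `ShellMeasureDecayRowsLevelOpTwoLevel`
(`decay_levelOp_cov` on the same family) — here for the cell-BLOCK row shape; ADDITIVE — imports J3 f1 + S117 ONLY and touches NO
host; [folklore]; 0 `def`, 0 `def … : Prop`, 0 sorry, 0 citation tags of Bałaban's.)

HONEST FRAMING.  Finite four-torus programme, rung (B)+1 only — NOT infinite volume, NOT a mass gap, NOT the Clay problem, NOT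
summit progress.  NE7c (`T4IndicatorShell.ShellWeightBound`) is NOT PRINTED in [Balaban 1983–89] and NOT PROVED; «NE7c ⇐ the named
binders» (trigger c3).  A WITNESS on the MODEL side (crew rule G-1): the hypothesis list of `decayRow_levelOp_cells_cov` is jointly
inhabited by the designed slot geometry (S117's `cells_disjoint cells_cover meanProfile_supp scale_lo scale_hi`), identity bond
matrices and cube gauges (`ε = 0`, `θ = 0` — `MultiscaleCoerciveTorus.defect_flat`), and the row shape FIRES at a POSITIVE rate with
every remaining hypothesis a displayed number.  Nothing of Bałaban's asserted, cited or discharged; census COUNT unchanged.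
HONEST DEPENDENCY (cell): continuum YM on T⁴ ⇐ BetaPertH ∧ nine spine estimates (0/9 proved); BetaPertH ⇐ (D1) ∧ (D4) ∧ CAP+tail;
G-an2-4 gates asym, D1 and NE2/3/4.
-/

noncomputable section

open Finset Function
open scoped Matrix ComplexConjugate BigOperators
open Summit.QuantumFields.BalabanUV.Beta
open Summit.QuantumFields.BalabanUV.Beta.BoxPoincare (Box)
open Summit.QuantumFields.BalabanUV.Beta.CovariantBoxPoincare (hol succ)
open Summit.QuantumFields.BalabanUV.Beta.MultiscaleCoerciveTorus
open Summit.QuantumFields.BalabanUV.Beta.MultiscaleDecayBudget (siteScale cellOf)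
open Summit.QuantumFields.BalabanUV.Beta.MultiscaleDistance (sdist)
open Summit.QuantumFields.BalabanUV.T4Continuum.ShellMeasureSlotCubeFamily
open Summit.QuantumFields.BalabanUV.T4Continuum.ShellMeasureDecayRowsLevelOpCells (decayRow_levelOp_cells_cov)
open Literature.MathematicalPhysics.QuantumFieldTheory.Balaban1983to89
open Literature.MathematicalPhysics.QuantumFieldTheory.Balaban1983to89.B9Thm37GluePU (bsrc btgt)
open Literature.MathematicalPhysics.QuantumFieldTheory.Balaban1983to89.B9Thm37GlueTorusCov (tblk torusComb)
open Literature.MathematicalPhysics.QuantumFieldTheory.Balaban1983to89.B9Thm37GlueTorusCovLevels (levelOp)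
open B5TorusCover (UT Ctr ctrU nC)

namespace Summit.QuantumFields.BalabanUV.T4Continuum.ShellMeasureDecayRowsLevelOpCellsSlot

variable {d : ℕ} [NeZero d] {N : Fin d → ℕ} [∀ i, NeZero (N i)] {Cp : Type} [Fintype Cp] [DecidableEq Cp] [Nonempty Cp]
variable {s L : ℕ} {Λ : Finset (Ctr N (L * s))} (hs : 1 ≤ s) (hL : 1 ≤ L) (hdiv : ∀ i, L * s ∣ N i)

omit [NeZero d] in
include hL in
/-- both cell sides of the two-level family are at most the coarse side `L·s`. [folklore] -/
theorem side_le_coarse (l : Bool) : (side s L l : ℝ) ≤ ((L * s : ℕ) : ℝ) := by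
  cases l
  · show ((s : ℕ) : ℝ) ≤ ((L * s : ℕ) : ℝ)
    have : s ≤ L * s := Nat.le_mul_of_pos_left s hL
    exact_mod_cast this
  · show (((L * s : ℕ)) : ℝ) ≤ ((L * s : ℕ) : ℝ)
    exact le_rfl

/-- **ROW J3's COVARIANT ROW SHAPE ON S117's TWO-LEVEL SLOT FAMILY, FLAT GAUGE POINT** (`decayRow_levelOp_cells_cov` BY NAME; S117's
`cells_disjoint cells_cover meanProfile_supp scale_lo scale_hi` and `Rm ≡ 1`, `g ≡ 1`, `ε ≡ 0` (`defect_flat`), `θ = 0`, `Smax := L·s`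
SUPPLIED): for all cells `c b′` of the family, the complexified cell block of `(levelOp)⁻¹` satisfies
`‖k c b′‖ ≤ (e^{4dκ}(Ls)²∕μ₀)·exp(−(κ·sdist (corner c) (corner b′)))`, `μ₀ = (1 − 0)·min(c_min²∕(4d), a_min∕4) − 2d·c_max²κ² − a_max(e^{2dκ} − 1)`;
displayed: `0 < c_min ≤ |c_b| ≤ c_max`, `0 ≤ a_min ≤ α_l ≤ a_max`, `κ ∈ [0,1]`, `hμ`. [folklore] -/
theorem decayRow_levelOp_cells_cov_slot_flatGauge
    {α : Bool → ℝ} {amin amax : ℝ} (hamin : 0 ≤ amin) (hα_lo : ∀ l, amin ≤ α l) (hα_hi : ∀ l, α l ≤ amax)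
    (c : UT N × Fin d → ℝ) {cmin cmax : ℝ} (hcmin : 0 < cmin) (hc_lo : ∀ b, cmin ≤ |c b|) (hc_hi : ∀ b, |c b| ≤ cmax)
    {κ : ℝ} (hκ0 : 0 ≤ κ) (hκ1 : κ ≤ 1)
    (hμ : 0 < (1 - (0 : ℝ)) * min (cmin ^ 2 / (4 * d)) (amin / 4) - 2 * d * cmax ^ 2 * κ ^ 2 -
      amax * (Real.exp (2 * d * κ) - 1))
    (cc b' : Cell s L Λ) :
    ‖Matrix.toEuclideanCLM (n := UT N × Cp) (𝕜 := ℂ)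
        ((Matrix.of fun p q : UT N × Cp =>
          if cellOf (side s L) (side_pos hs hL) (side_dvd hdiv) lvl (zc hs hL hdiv) (cells_cover (Λ := Λ) hs hL hdiv) p.1 = cc ∧
              cellOf (side s L) (side_pos hs hL) (side_dvd hdiv) lvl (zc hs hL hdiv) (cells_cover (Λ := Λ) hs hL hdiv) q.1 = b' then
            (Ring.inverse (levelOp bsrc btgt c (fun _ => (oneM : Cp → Cp → ℝ))
              (fun l x => ctrU N (side s L l) (tblk (side_pos hs hL l) (side_dvd hdiv l) x))
              (fun l x => meanProfile hs hL hdiv Λ l (ctrU N (side s L l) (tblk (side_pos hs hL l) (side_dvd hdiv l) x)))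
              (fun l x => (torusComb (side_pos hs hL l) (side_dvd hdiv l)).tr (fun _ => (oneM : Cp → Cp → ℝ)) x)
              (treeWeight d s L α))) (Pi.single q 1) p
          else 0).map Complex.ofReal)‖ ≤
      (Real.exp (4 * d * κ) * ((L * s : ℕ) : ℝ) ^ 2 /
          ((1 - (0 : ℝ)) * min (cmin ^ 2 / (4 * d)) (amin / 4) - 2 * d * cmax ^ 2 * κ ^ 2 - amax * (Real.exp (2 * d * κ) - 1))) *
        Real.exp (-(κ * sdist bsrc btgt
          (siteScale (side s L) (side_pos hs hL) (side_dvd hdiv) lvl (zc hs hL hdiv) (cells_cover (Λ := Λ) hs hL hdiv))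
          (ctrU N (side s L (lvl cc)) (zc hs hL hdiv cc)) (ctrU N (side s L (lvl b')) (zc hs hL hdiv b')))) :=
  decayRow_levelOp_cells_cov (side s L) (side_pos hs hL) (side_dvd hdiv) lvl (zc hs hL hdiv) (cells_disjoint hs hL hdiv)
    (cells_cover hs hL hdiv) (fun _ => oneM) (fun _ i j => oneM_orth i j) (treeWeight d s L α)
    (treeWeight_nonneg fun l => hamin.trans (hα_lo l)) (meanProfile hs hL hdiv Λ) (meanProfile_supp hs hL hdiv)
    (hamin.trans ((hα_lo true).trans (hα_hi true))) (scale_hi hs hL hdiv hα_hi) c hc_hi hκ0 hκ1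
    hamin (scale_lo hs hL hdiv hα_lo) hcmin hc_lo
    (fun _ _ => oneM) (fun _ _ i i' => oneM_orth i i') (fun _ => 0) (fun _ => le_rfl) (fun k v i hv u => defect_flat _ v i hv u)
    (fun k => by simp) hμ (fun k => side_le_coarse hL (lvl k)) cc b'

/-- NON-VACUITY OF THE DISPLAYED SMALLNESS AT A POSITIVE RATE, `d = 4` (`c ≡ 1`, `α ≡ 1`, `κ = 10⁻³`): the same number as S116 = J1 (b)'s
instance, re-decided here (`|e^x − 1 − x| ≤ x²` for `|x| ≤ 1`). [folklore] -/
theorem mu0_pos_d4 : 0 < (1 - (0 : ℝ)) * min ((1 : ℝ) ^ 2 / (4 * ((4 : ℕ) : ℝ))) ((1 : ℝ) / 4) -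
    2 * ((4 : ℕ) : ℝ) * (1 : ℝ) ^ 2 * (1 / 1000) ^ 2 - 1 * (Real.exp (2 * ((4 : ℕ) : ℝ) * (1 / 1000)) - 1) := by
  have hx : |(2 * ((4 : ℕ) : ℝ) * (1 / 1000))| ≤ 1 := by norm_num [abs_of_nonneg]
  have h := Real.abs_exp_sub_one_sub_id_le hx
  have h2 := (abs_le.mp h).2
  rw [min_eq_left (by norm_num)]
  norm_num at h2 ⊢
  linarith

/-- RULE G-1 AT A POSITIVE RATE: the E6-row shape FIRES on the `d = 4` slot family (torus `4⁴`, `s = 1`, `L = 2`, ANY slot `Λ`,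
fibre `Unit`, `c ≡ 1`, `α ≡ 1`, rate `κ = 10⁻³`) for EVERY pair of cells — every hypothesis discharged (`mu0_pos_d4`). [folklore] -/
example (Λ : Finset (Ctr (fun _ : Fin 4 => 4) (2 * 1))) (cc b' : Cell 1 2 Λ) :=
  decayRow_levelOp_cells_cov_slot_flatGauge (Cp := Unit) (Λ := Λ) le_rfl (by norm_num) (fun _ => ⟨2, rfl⟩) (α := fun _ => 1)
    (amin := 1) (amax := 1) zero_le_one (fun _ => le_rfl) (fun _ => le_rfl) (fun _ => 1) (cmin := 1) (cmax := 1) one_pos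
    (fun _ => by simp) (fun _ => by simp) (κ := 1 / 1000) (by norm_num) (by norm_num) mu0_pos_d4 cc b'

end Summit.QuantumFields.BalabanUV.T4Continuum.ShellMeasureDecayRowsLevelOpCellsSlot

end
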